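import Literature.Geometry.Riemannian.MetricFlowFConvergenceTimewise
import Literature.Geometry.Riemannian.MetricFlowHeatFlow
import HarnessLib

/-!
# Convergence of conjugate heat flows, measures and points within a correspondence
# (Bamler 2023, §6.3 Def. 6.5, Lemma 6.6; §6.4 Defs. 6.7, 6.8)

R. Bamler, *Compactness theory of the space of super Ricci flows*, Invent. Math. 233 (2023),
§6.3–6.4 (arXiv v1 Defs. 130, 133, 135, Lemma 132), for metric flows `𝒳^i` over `I^{′,i}`,
`i ∈ ℕ ∪ {∞}`, in a correspondence `ℭ` over `I''` (here: a `MetricFlow.FamilyCorrespondence`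
indexed by `Option ℕ`, `none = ∞`):

* Def. 6.5 (arXiv Def. 130), `CHFConvergesWithinOn` / `CHFConvergesWithin`: conjugate heat flows
  `(μ^i_t)_{t ∈ I^i_*}` converge within `ℭ`, uniformly over `J`, iff `J ⊆ I^i_*` for large
  `i ≤ ∞` and there are measurable `E_i ⊆ I''` with, for large `i`,
  `J ∩ I^∞_* ⊆ (I^i_* ∩ I'') ∖ E_i = (I^∞_* ∩ I'') ∖ E_i ⊆ I''^{,i} ∩ I''^{,∞}`, `|E_i| → 0`, and
  `sup_{t ∈ (I^∞_* ∩ I'') ∖ E_i} d^{Z_t}_{W₁}((φ^i_t)_* μ^i_t, (φ^∞_t)_* μ^∞_t) → 0` (the supremum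
  is taken over those `t` at which both embeddings are defined — all of `(I^∞_* ∩ I'') ∖ E_i` for
  large `i`); "on compact time-intervals" (`CHFConvergesWithinOnCompacts`) replaces `I''` by
  `I'' ∩ I₀` and `J` by `J ∩ I₀` for compact `I₀ ⊆ I^∞_*`; "time-wise at `t`" replaces `J` by
  `J ∪ {t}` (`CHFConvergesWithinTimewiseAt`);
* Lemma 6.6 (arXiv Lemma 132), `chfConvergesWithin_of_fConvergesWithin`: `𝔽`-convergence of
  metric flow pairs within `ℭ` uniformly over `J` (`MetricFlowPair.FConvergesWithin`) implies the
  convergence of their measures within `ℭ` (Remark 5.7: a coupling `q_t` of `μ¹_t, μ²_t` pushed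
  forward by `φ¹_t × φ²_t` couples the push-forwards, and at `s = t` the integrand of the
  `𝔽`-distance is `d^{Z_t}(φ¹_t x¹, φ²_t x²)`);
* Def. 6.7 (arXiv Def. 133), `MeasuresConvergeWithin` / `PointsConvergeWithin`: probability
  measures `μ^i ∈ 𝒫(𝒳^i_{T_i})` converge within `ℭ` iff `T_i → T_∞` and the conjugate heat flows
  they generate (`MetricFlow.chfOf`, a conjugate heat flow by `isConjugateHeatFlow_chfOf`)
  converge within `ℭ` on compact time-intervals of `I^{′,∞} ∩ (−∞, T_∞)`; points via `δ_{x^i}`;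
* Def. 6.8 (arXiv Def. 135), `MeasuresStrictlyConvergeWithin` / `PointsStrictlyConvergeWithin` at
  a fixed time `T` and `pointsStrictlyConvergeWithin_iff_measures`
  (`d_{W₁}(δ_a, δ_b) = d(a, b)` in any metric space: `edist_le_wassersteinW1_dirac`,
  `wassersteinW1_dirac_dirac_le`).

Definition lane: the definitions are `Prop`-valued with explicit parameters; the lemmas are
proved; no named facts.

## References

* R. H. Bamler, *Compactness theory of the space of super Ricci flows*, Invent. Math. 233 (2023),
  1121–1277 (arXiv:2008.09298), §5.1 Rem. 5.7; §6.3 Def. 6.5, Lemma 6.6; §6.4 Defs. 6.7, 6.8.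
  [Bamler2023]
-/

noncomputable section

open Set MeasureTheory Filter TopologicalSpace Function
open scoped Topology ENNReal NNReal

namespace Literature.Geometry.Riemannian

universe u

/-! ### Couplings pushed forward; `d_{W₁}` of Dirac masses in a general metric space -/

section General

variable {X₁ X₂ Y₁ Y₂ : Type*} [MeasurableSpace X₁] [MeasurableSpace X₂] [MeasurableSpace Y₁]
  [MeasurableSpace Y₂]

/-- **A coupling pushed forward by `f × g` couples the push-forwards** (Bamler 2023, §5.1,
Rem. 5.7). [cite: Bamler2023, §5.1, Rem. 5.7] -/
theorem IsCoupling.map_prodMap {μ₁ : Measure X₁} {μ₂ : Measure X₂} {q : Measure (X₁ × X₂)}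
    (hq : IsCoupling μ₁ μ₂ q) {f : X₁ → Y₁} {g : X₂ → Y₂} (hf : Measurable f) (hg : Measurable g) :
    IsCoupling (μ₁.map f) (μ₂.map g) (q.map (Prod.map f g)) := by
  obtain ⟨hprob, h1, h2⟩ := hq
  haveI := hprob
  refine ⟨Measure.isProbabilityMeasure_map (hf.prodMap hg).aemeasurable, ?_, ?_⟩
  · rw [Measure.fst, Measure.map_map measurable_fst (hf.prodMap hg), ← h1, Measure.fst,
      Measure.map_map hf measurable_fst]
    rfl
  · rw [Measure.snd, Measure.map_map measurable_snd (hf.prodMap hg), ← h2, Measure.snd,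
      Measure.map_map hg measurable_snd]
    rfl

variable {X : Type*} [MetricSpace X] [MeasurableSpace X] [BorelSpace X]

/-- `d(a, b) ≤ d_{W₁}(δ_a, δ_b)` in any metric space: a coupling of `δ_a, δ_b` is concentrated at
`(a, b)`. [cite: Bamler2023, §2.1 (Wasserstein distance)] -/
theorem edist_le_wassersteinW1_dirac (a b : X) :
    edist a b ≤ wassersteinW1 (Measure.dirac a) (Measure.dirac b) := by
  refine le_iInf fun q ↦ ?_
  obtain ⟨hprob, h1, h2⟩ := q.2
  have ha : ∀ᵐ p ∂(q : Measure (X × X)), p.1 = a := by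
    rw [ae_iff]
    have : {p : X × X | ¬p.1 = a} = Prod.fst ⁻¹' {a}ᶜ := rfl
    rw [this, ← Measure.fst_apply (measurableSet_singleton a).compl, h1,
      Measure.dirac_apply' _ (measurableSet_singleton a).compl]
    simp
  have hb : ∀ᵐ p ∂(q : Measure (X × X)), p.2 = b := by
    rw [ae_iff]
    have : {p : X × X | ¬p.2 = b} = Prod.snd ⁻¹' {b}ᶜ := rfl
    rw [this, ← Measure.snd_apply (measurableSet_singleton b).compl, h2,
      Measure.dirac_apply' _ (measurableSet_singleton b).compl]
    simp
  have heq : ∫⁻ p, edist p.1 p.2 ∂(q : Measure (X × X)) =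
      ∫⁻ _, edist a b ∂(q : Measure (X × X)) := by
    refine lintegral_congr_ae ?_
    filter_upwards [ha, hb] with p hp1 hp2
    rw [hp1, hp2]
  rw [heq, lintegral_const, measure_univ, mul_one]

/-- `d_{W₁}(δ_a, δ_b) ≤ d(a, b)` in any metric space (the coupling `δ_{(a,b)}`); with
`edist_le_wassersteinW1_dirac` this is the equality `wassersteinW1_dirac_dirac` of
`MetricFlowSliceUnion.lean` without its separability hypothesis.
[cite: Bamler2023, §2.1 (Wasserstein distance)] -/
theorem wassersteinW1_dirac_dirac_le (a b : X) :
    wassersteinW1 (Measure.dirac a) (Measure.dirac b) ≤ edist a b := by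
  have hc : IsCoupling (Measure.dirac a) (Measure.dirac b) (Measure.dirac (a, b)) :=
    ⟨inferInstance, by rw [Measure.fst, Measure.map_dirac' measurable_fst],
      by rw [Measure.snd, Measure.map_dirac' measurable_snd]⟩
  refine (wassersteinW1_le_lintegral hc).trans_eq ?_
  rw [lintegral_dirac]

end General

namespace MetricFlow

/-! ### The conjugate heat flow generated by a probability measure -/

variable {I : Set ℝ}

/-- **The conjugate heat flow with initial condition `μ ∈ 𝒫(𝒳_T)`**:
`μ̃_t := ∫ ν_{x;t} dμ(x)` (`Measure.bind`), `t ≤ T` (Bamler 2023, §6.4, Def. 6.7: "the conjugate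
heat flows `(μ̃^i_t)` with initial condition `μ̃^i_{T_i} = μ^i`").
[cite: Bamler2023, §6.4, Def. 6.7] -/
def chfOf (𝒳 : MetricFlow.{u} I) {T : I} (μ : Measure (𝒳.Slice T)) (t : I) : Measure (𝒳.Slice t) :=
  μ.bind fun x ↦ 𝒳.condKernel x t

/-- At the initial time the generated flow is `μ` (`ν_{x;T} = δ_x`).
[cite: Bamler2023, §6.4, Def. 6.7] -/
theorem chfOf_self (𝒳 : MetricFlow.{u} I) {T : I} (μ : Measure (𝒳.Slice T)) : 𝒳.chfOf μ T = μ := by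
  have : (fun x : 𝒳.Slice T ↦ 𝒳.condKernel x T) = Measure.dirac :=
    funext fun x ↦ 𝒳.condKernel_self x
  rw [chfOf, this]
  exact Measure.bind_dirac

/-- **The generated flow is a conjugate heat flow over `I ∩ (−∞, T]`** (reproduction formula;
cf. `isConjugateHeatFlow_condKernel`). [cite: Bamler2023, §3.2, Definition (conjugate heat flow)] -/
theorem isConjugateHeatFlow_chfOf (𝒳 : MetricFlow.{u} I) {T : I} (μ : Measure (𝒳.Slice T))
    [IsProbabilityMeasure μ] : 𝒳.IsConjugateHeatFlow (I ∩ Iic (T : ℝ)) (𝒳.chfOf μ) := by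
  refine ⟨fun t ht ↦ ⟨?_⟩, ?_⟩
  · rw [chfOf, Measure.bind_apply MeasurableSet.univ (𝒳.measurable_condKernel ht.2).aemeasurable]
    have : ∀ x : 𝒳.Slice T, 𝒳.condKernel x t univ = 1 := fun x ↦
      (𝒳.isProbabilityMeasure_condKernel x ht.2).measure_univ
    simp only [this, lintegral_const, measure_univ, mul_one]
  · intro s t hs ht hst S hS
    rw [chfOf, Measure.bind_apply hS (𝒳.measurable_condKernel hs.2).aemeasurable, chfOf,
      Measure.lintegral_bind (𝒳.measurable_condKernel ht.2).aemeasurable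
        (𝒳.measurable_condKernel_apply hst hS).aemeasurable]
    exact lintegral_congr fun x ↦ 𝒳.reproduction hst ht.2 x S hS

/-! ### Def. 6.5: convergence of conjugate heat flows within a correspondence -/

namespace FamilyCorrespondence

variable {Iι : Option ℕ → Set ℝ} {𝒳 : ∀ o, MetricFlow.{u} (Iι o)} {I'' : Set ℝ}

/-- The quantity of Def. 6.5 (3): `d^{Z_t}_{W₁}((φⁿ_t)_* μⁿ_t, (φ^∞_t)_* μ^∞_t)` at a time `t` at
which both embeddings are defined. [cite: Bamler2023, §6.3, Def. 6.5] -/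
def measureDistAt (ℭ : FamilyCorrespondence 𝒳 I'') (μ : ∀ o (t : Iι o), Measure ((𝒳 o).Slice t))
    (n : ℕ) (t : ℝ) (h₁ : t ∈ ℭ.dom (some n)) (h₂ : t ∈ ℭ.dom none) : ℝ≥0∞ :=
  wassersteinW1 (X := ℭ.Z ⟨t, (ℭ.dom_subset (some n) h₁).2⟩)
    ((μ (some n) ⟨t, (ℭ.dom_subset (some n) h₁).1⟩).map (ℭ.φ (some n) t h₁))
    ((μ none ⟨t, (ℭ.dom_subset none h₂).1⟩).map (ℭ.φ none t h₂))

/-- **Convergence of conjugate heat flows within `ℭ` restricted to a window `I₀`, uniform over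
`J`** (Bamler 2023, §6.3, Def. 6.5 / arXiv Def. 130, for the correspondence `ℭ|_{I'' ∩ I₀}`): with
`I^i_* = Istar i`, `J ⊆ I^i_*` for large `i ≤ ∞`, and measurable `E_i ⊆ I'' ∩ I₀` with, for large
`i`, `J ∩ I^∞_* ⊆ (I^i_* ∩ I'' ∩ I₀) ∖ E_i = (I^∞_* ∩ I'' ∩ I₀) ∖ E_i ⊆ I''^{,i} ∩ I''^{,∞}`,
`|E_i| → 0`, and `sup_t d^{Z_t}_{W₁}((φ^i_t)_* μ^i_t, (φ^∞_t)_* μ^∞_t) → 0`, the supremum over the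
`t ∈ (I^∞_* ∩ I'' ∩ I₀) ∖ E_i` at which both embeddings are defined (all of them for large `i`).
[cite: Bamler2023, §6.3, Def. 6.5] -/
def CHFConvergesWithinOn (ℭ : FamilyCorrespondence 𝒳 I'') (Istar : Option ℕ → Set ℝ)
    (μ : ∀ o (t : Iι o), Measure ((𝒳 o).Slice t)) (I₀ J : Set ℝ) : Prop :=
  J ⊆ Istar none ∧ (∀ᶠ n in atTop, J ⊆ Istar (some n)) ∧
  ∃ E : ℕ → Set ℝ, (∀ n, MeasurableSet (E n)) ∧ (∀ n, E n ⊆ I'' ∩ I₀) ∧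
    (∀ᶠ n in atTop, J ∩ Istar none ⊆ (Istar (some n) ∩ (I'' ∩ I₀)) \ E n ∧
      (Istar (some n) ∩ (I'' ∩ I₀)) \ E n = (Istar none ∩ (I'' ∩ I₀)) \ E n ∧
      (Istar none ∩ (I'' ∩ I₀)) \ E n ⊆ ℭ.dom (some n) ∩ ℭ.dom none) ∧
    Tendsto (fun n ↦ volume (E n)) atTop (𝓝 0) ∧
    Tendsto (fun n ↦ ⨆ (t : ℝ) (h₁ : t ∈ ℭ.dom (some n)) (h₂ : t ∈ ℭ.dom none)
      (_ : t ∈ (Istar none ∩ (I'' ∩ I₀)) \ E n), ℭ.measureDistAt μ n t h₁ h₂) atTop (𝓝 0)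

/-- **Convergence of conjugate heat flows within `ℭ`, uniform over `J`** (Bamler 2023, §6.3,
Def. 6.5 / arXiv Def. 130): `CHFConvergesWithinOn` with no window.
[cite: Bamler2023, §6.3, Def. 6.5] -/
def CHFConvergesWithin (ℭ : FamilyCorrespondence 𝒳 I'') (Istar : Option ℕ → Set ℝ)
    (μ : ∀ o (t : Iι o), Measure ((𝒳 o).Slice t)) (J : Set ℝ) : Prop :=
  ℭ.CHFConvergesWithinOn Istar μ univ J

/-- **… on compact time-intervals** (Def. 6.5, second paragraph): for every compact interval
`I₀ = [a, b] ⊆ I^∞_*`, convergence within `ℭ|_{I'' ∩ I₀}` uniform over `J ∩ I₀`.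
[cite: Bamler2023, §6.3, Def. 6.5] -/
def CHFConvergesWithinOnCompacts (ℭ : FamilyCorrespondence 𝒳 I'') (Istar : Option ℕ → Set ℝ)
    (μ : ∀ o (t : Iι o), Measure ((𝒳 o).Slice t)) (J : Set ℝ) : Prop :=
  ∀ a b : ℝ, Icc a b ⊆ Istar none → ℭ.CHFConvergesWithinOn Istar μ (Icc a b) (J ∩ Icc a b)

/-- **… time-wise at `t`** (Def. 6.5, last paragraph): `J` replaced by `J ∪ {t}`.
[cite: Bamler2023, §6.3, Def. 6.5] -/
def CHFConvergesWithinTimewiseAt (ℭ : FamilyCorrespondence 𝒳 I'') (Istar : Option ℕ → Set ℝ)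
    (μ : ∀ o (t : Iι o), Measure ((𝒳 o).Slice t)) (J : Set ℝ) (t : ℝ) : Prop :=
  ℭ.CHFConvergesWithin Istar μ (insert t J)

/-- No window means the window `univ`. [cite: Bamler2023, §6.3, Def. 6.5] -/
theorem chfConvergesWithin_iff (ℭ : FamilyCorrespondence 𝒳 I'') (Istar : Option ℕ → Set ℝ)
    (μ : ∀ o (t : Iι o), Measure ((𝒳 o).Slice t)) (J : Set ℝ) :
    ℭ.CHFConvergesWithin Istar μ J ↔ ℭ.CHFConvergesWithinOn Istar μ univ J := Iff.rfl

/-! ### Def. 6.7: convergence of probability measures and points within a correspondence -/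

/-- **Convergence of probability measures `μ^i ∈ 𝒫(𝒳^i_{T_i})` within `ℭ`, uniform over `J`**
(Bamler 2023, §6.4, Def. 6.7 / arXiv Def. 133): `T_i → T_∞` and the generated conjugate heat flows
`(μ̃^i_t)_{t < T_i}` (`chfOf`) converge within `ℭ` on compact time-intervals of
`I^{′,∞} ∩ (−∞, T_∞)`, uniformly over `J`. [cite: Bamler2023, §6.4, Def. 6.7] -/
def MeasuresConvergeWithin (ℭ : FamilyCorrespondence 𝒳 I'') (T : ∀ o, Iι o)
    (μ : ∀ o, Measure ((𝒳 o).Slice (T o))) (J : Set ℝ) : Prop :=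
  Tendsto (fun n ↦ ((T (some n) : Iι (some n)) : ℝ)) atTop (𝓝 (T none)) ∧
    ℭ.CHFConvergesWithinOnCompacts (fun o ↦ Iι o ∩ Iio (T o : ℝ))
      (fun o ↦ (𝒳 o).chfOf (μ o)) J

/-- **Convergence of points `x^i ∈ 𝒳^i_{T_i}` within `ℭ`, uniform over `J`** (Def. 6.7:
`δ_{x^i} → δ_{x^∞}` within `ℭ`, i.e. the conjugate heat kernels `ν_{x^i;t}` converge).
[cite: Bamler2023, §6.4, Def. 6.7] -/
def PointsConvergeWithin (ℭ : FamilyCorrespondence 𝒳 I'') (T : ∀ o, Iι o)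
    (x : ∀ o, (𝒳 o).Slice (T o)) (J : Set ℝ) : Prop :=
  ℭ.MeasuresConvergeWithin T (fun o ↦ Measure.dirac (x o)) J

/-! ### Def. 6.8: strict convergence at a fixed time -/

/-- **Strict convergence of probability measures `μ^i ∈ 𝒫(𝒳^i_T)` within `ℭ`** at a time `T`
at which all embeddings are defined (Bamler 2023, §6.4, Def. 6.8 / arXiv Def. 135):
`(φ^i_T)_* μ^i → (φ^∞_T)_* μ^∞` in `d^{Z_T}_{W₁}`. [cite: Bamler2023, §6.4, Def. 6.8] -/
def MeasuresStrictlyConvergeWithin (ℭ : FamilyCorrespondence 𝒳 I'') {T : ℝ} (hT : ∀ o, T ∈ ℭ.dom o)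
    (μ : ∀ o, Measure ((𝒳 o).Slice ⟨T, (ℭ.dom_subset o (hT o)).1⟩)) : Prop :=
  Tendsto (fun n ↦ wassersteinW1 (X := ℭ.Z ⟨T, (ℭ.dom_subset none (hT none)).2⟩)
    ((μ (some n)).map (ℭ.φ (some n) T (hT (some n)))) ((μ none).map (ℭ.φ none T (hT none))))
    atTop (𝓝 0)

/-- **Strict convergence of points `x^i ∈ 𝒳^i_T` within `ℭ`**: `φ^i_T(x^i) → φ^∞_T(x^∞)` in `Z_T`
(Def. 6.8). [cite: Bamler2023, §6.4, Def. 6.8] -/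
def PointsStrictlyConvergeWithin (ℭ : FamilyCorrespondence 𝒳 I'') {T : ℝ} (hT : ∀ o, T ∈ ℭ.dom o)
    (x : ∀ o, (𝒳 o).Slice ⟨T, (ℭ.dom_subset o (hT o)).1⟩) : Prop :=
  Tendsto (fun n ↦ (ℭ.φ (some n) T (hT (some n)) (x (some n)) :
      ℭ.Z ⟨T, (ℭ.dom_subset none (hT none)).2⟩))
    atTop (𝓝 (ℭ.φ none T (hT none) (x none)))

/-- **Points strictly converge iff their Dirac masses strictly converge** (Def. 6.8: "or,
equivalently"; `(φ_T)_* δ_x = δ_{φ_T x}` and `d_{W₁}(δ_a, δ_b) = d(a, b)`).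
[cite: Bamler2023, §6.4, Def. 6.8] -/
theorem pointsStrictlyConvergeWithin_iff_measures (ℭ : FamilyCorrespondence 𝒳 I'') {T : ℝ}
    (hT : ∀ o, T ∈ ℭ.dom o) (x : ∀ o, (𝒳 o).Slice ⟨T, (ℭ.dom_subset o (hT o)).1⟩) :
    ℭ.PointsStrictlyConvergeWithin hT x ↔
      ℭ.MeasuresStrictlyConvergeWithin hT (fun o ↦ Measure.dirac (x o)) := by
  have hmeas : ∀ o, Measurable (ℭ.φ o T (hT o)) := fun o ↦
    (ℭ.isometry o T (hT o)).continuous.measurable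
  unfold PointsStrictlyConvergeWithin MeasuresStrictlyConvergeWithin
  rw [tendsto_iff_edist_tendsto_0]
  refine tendsto_congr' (Eventually.of_forall fun n ↦ ?_)
  show edist _ _ = wassersteinW1 _ _
  rw [Measure.map_dirac' (hmeas (some n)), Measure.map_dirac' (hmeas none)]
  exact le_antisymm (edist_le_wassersteinW1_dirac _ _) (wassersteinW1_dirac_dirac_le _ _)

end FamilyCorrespondence

end MetricFlow

/-! ### Lemma 6.6: `𝔽`-convergence of pairs implies convergence of their measures -/

namespace MetricFlowPair

open MetricFlow

variable {I₁ I₂ : Set ℝ} {P₁ : MetricFlowPair.{u} I₁} {P₂ : MetricFlowPair.{u} I₂} {I'' : Set ℝ}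
  {ℭ : Correspondence₂ P₁.flow P₂.flow I''} {E J : Set ℝ} {r : ℝ}

/-- **Remark 5.7** (Bamler 2023, §5.1, arXiv Rem. 107): an admissible radius `r` for `d_𝔽^{ℭ,J}`
with exceptional set `E` bounds `d^{Z_t}_{W₁}((φ¹_t)_* μ¹_t, (φ²_t)_* μ²_t) ≤ r` for every
`t ∈ I'' ∖ E` (push the coupling `q_t` forward by `φ¹_t × φ²_t`; at `s = t` the integrand of the
`𝔽`-distance is `d_{W₁}(δ_{φ¹ x¹}, δ_{φ² x²}) = d^{Z_t}(φ¹_t x¹, φ²_t x²)`).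
[cite: Bamler2023, §5.1, Rem. 5.7] -/
theorem FDistAdmissibleWith.wassersteinW1_map_le (h : FDistAdmissibleWith P₁ P₂ ℭ E J r) {t : ℝ}
    (ht : t ∈ I'' \ E) (h₁ : t ∈ ℭ.dom₁) (h₂ : t ∈ ℭ.dom₂) :
    wassersteinW1 (X := ℭ.Z ⟨t, (ℭ.dom₁_subset h₁).2⟩)
      ((P₁.μ ⟨t, (ℭ.dom₁_subset h₁).1⟩).map (ℭ.φ₁ t h₁))
      ((P₂.μ ⟨t, (ℭ.dom₂_subset h₂).1⟩).map (ℭ.φ₂ t h₂)) ≤ ENNReal.ofReal r := by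
  obtain ⟨_, _, _, _, hE₁, hE₂, _, q, hq, hint⟩ := h
  have hm₁ : Measurable (ℭ.φ₁ t h₁) := (ℭ.isometry₁ t h₁).continuous.measurable
  have hm₂ : Measurable (ℭ.φ₂ t h₂) := (ℭ.isometry₂ t h₂).continuous.measurable
  have hc := (hq t ht).map_prodMap hm₁ hm₂
  refine ((wassersteinW1_le_lintegral hc).trans (lintegral_map_le _ _)).trans ?_
  refine le_trans (lintegral_mono fun p ↦ ?_) (hint t ht t ht le_rfl)
  -- at `s = t` the integrand is `d_{W₁}(δ_{φ¹ x¹}, δ_{φ² x²}) = d(φ¹ x¹, φ² x²)`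
  show edist (Prod.map (ℭ.φ₁ t h₁) (ℭ.φ₂ t h₂) p).1 (Prod.map (ℭ.φ₁ t h₁) (ℭ.φ₂ t h₂) p).2 ≤
    kernelDistWithin P₁ P₂ ℭ (hE₁ ht) (hE₂ ht) (hE₁ ht) (hE₂ ht) p
  rw [Prod.map_fst, Prod.map_snd]
  unfold kernelDistWithin
  rw [P₁.flow.condKernel_self, P₂.flow.condKernel_self, Measure.map_dirac' hm₁,
    Measure.map_dirac' hm₂]
  exact edist_le_wassersteinW1_dirac _ _

end MetricFlowPair

/-- **Bamler 2023, Lemma 6.6 (arXiv v1 Lemma 132): `𝔽`-convergence of metric flow pairs within a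
correspondence, uniform over `J`, implies the convergence of their conjugate heat flows within
the correspondence, uniform over `J`** ("a direct consequence of Definition 5.6, see also
Remark 5.7"): with radii `rₙ → 0`, `d_𝔽^{ℭ,J}(Pₙ, P_∞) < rₙ` for large `n`, their exceptional sets
`Eₙ` (`|Eₙ| ≤ rₙ²`, `J ⊆ I'' ∖ Eₙ ⊆ I''^{,n} ∩ I''^{,∞} ⊆ I^{′,n} ∩ I^{′,∞}`) and
`d^{Z_t}_{W₁}((φⁿ_t)_* μⁿ_t, (φ^∞_t)_* μ^∞_t) ≤ rₙ` on `I'' ∖ Eₙ`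
(`FDistAdmissibleWith.wassersteinW1_map_le`). [cite: Bamler2023, §6.3, Lemma 6.6] -/
theorem chfConvergesWithin_of_fConvergesWithin {I₀ I'' : Set ℝ} {P : ℕ → MetricFlowPair.{u} I₀}
    {Pinf : MetricFlowPair.{u} I₀}
    {ℭ : MetricFlow.FamilyCorrespondence (fun o : Option ℕ ↦ (o.elim Pinf P).flow) I''} {J : Set ℝ}
    (h : MetricFlowPair.FConvergesWithin P Pinf ℭ J) :
    ℭ.CHFConvergesWithin (fun o ↦ (o.elim Pinf P).I') (fun o ↦ (o.elim Pinf P).μ) J := by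
  classical
  set D : ℕ → ℝ≥0∞ := fun n ↦ MetricFlowPair.fDistWithin (P n) Pinf (ℭ.pair (some n) none) J
    with hD
  -- radii `r n = (D n).toReal + 1/(n+1) → 0`, eventually `D n < r n`
  set r : ℕ → ℝ := fun n ↦ (D n).toReal + 1 / ((n : ℝ) + 1) with hr
  have hr0 : ∀ n, 0 < r n := fun n ↦ by
    have : (0 : ℝ) < 1 / ((n : ℝ) + 1) := by positivity
    exact add_pos_of_nonneg_of_pos ENNReal.toReal_nonneg this
  have hrt : Tendsto r atTop (𝓝 0) := by
    have h1 : Tendsto (fun n ↦ (D n).toReal) atTop (𝓝 0) := by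
      have := (ENNReal.tendsto_toReal ENNReal.zero_ne_top).comp h
      rwa [ENNReal.toReal_zero] at this
    have h2 : Tendsto (fun n : ℕ ↦ 1 / ((n : ℝ) + 1)) atTop (𝓝 0) :=
      tendsto_one_div_add_atTop_nhds_zero_nat
    have := h1.add h2
    rw [add_zero] at this
    exact this
  have hlt : ∀ᶠ n in atTop, D n < ENNReal.ofReal (r n) := by
    filter_upwards [h (Iio_mem_nhds zero_lt_one)] with n hn
    have hfin : D n ≠ ⊤ := (hn.trans ENNReal.one_lt_top).ne
    rw [← ENNReal.ofReal_toReal hfin, ENNReal.ofReal_lt_ofReal_iff (hr0 n)]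
    have : (0 : ℝ) < 1 / ((n : ℝ) + 1) := by positivity
    show (D n).toReal < (D n).toReal + 1 / ((n : ℝ) + 1)
    linarith
  -- the exceptional sets
  have hex : ∀ n, ∃ E : Set ℝ, D n < ENNReal.ofReal (r n) →
      MetricFlowPair.FDistAdmissibleWith (P n) Pinf (ℭ.pair (some n) none) E J (r n) := by
    intro n
    by_cases hn : D n < ENNReal.ofReal (r n)
    · obtain ⟨E, hE⟩ := MetricFlowPair.exists_fDistAdmissibleWith_of_fDistWithin_lt (hr0 n) hn
      exact ⟨E, fun _ ↦ hE⟩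
    · exact ⟨∅, fun h' ↦ absurd h' hn⟩
  choose E hE using hex
  set E' : ℕ → Set ℝ := fun n ↦ if D n < ENNReal.ofReal (r n) then E n else ∅ with hE'
  have hE'eq : ∀ n, D n < ENNReal.ofReal (r n) → E' n = E n := fun n hn ↦ if_pos hn
  have hadm : ∀ᶠ n in atTop, MetricFlowPair.FDistAdmissibleWith (P n) Pinf (ℭ.pair (some n) none)
      (E' n) J (r n) := by
    filter_upwards [hlt] with n hn
    rw [hE'eq n hn]; exact hE n hn
  refine ⟨?_, ?_, E', fun n ↦ ?_, fun n ↦ ?_, ?_, ?_, ?_⟩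
  · -- `J ⊆ I^∞_*`: eventually `J ⊆ I'' ∖ E ⊆ dom ∞ ⊆ I^{′,∞}`
    obtain ⟨n, hn⟩ := hadm.exists
    obtain ⟨_, _, _, hJ, _, hE₂, _⟩ := hn
    exact fun t ht ↦ ((ℭ.pair (some n) none).dom₂_subset (hE₂ (hJ ht))).1
  · filter_upwards [hadm] with n hn
    obtain ⟨_, _, _, hJ, hE₁, _, _⟩ := hn
    exact fun t ht ↦ ((ℭ.pair (some n) none).dom₁_subset (hE₁ (hJ ht))).1
  · by_cases hn : D n < ENNReal.ofReal (r n)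
    · rw [hE'eq n hn]; exact (hE n hn).measurableSet
    · simp only [hE', if_neg hn]; exact MeasurableSet.empty
  · by_cases hn : D n < ENNReal.ofReal (r n)
    · rw [hE'eq n hn, inter_univ]; exact (hE n hn).subset
    · simp only [hE', if_neg hn]; exact empty_subset _
  · filter_upwards [hadm] with n hn
    obtain ⟨_, _, hEI, hJ, hE₁, hE₂, _⟩ := hn
    have h1 : I'' \ E' n ⊆ (P n).I' := fun t ht ↦ ((ℭ.pair (some n) none).dom₁_subset (hE₁ ht)).1
    have h2 : I'' \ E' n ⊆ Pinf.I' := fun t ht ↦ ((ℭ.pair (some n) none).dom₂_subset (hE₂ ht)).1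
    have e1 : ((P n).I' ∩ (I'' ∩ univ)) \ E' n = I'' \ E' n := by
      ext t; simp only [inter_univ, Set.mem_sdiff, mem_inter_iff]
      exact ⟨fun ⟨⟨_, h1'⟩, h2'⟩ ↦ ⟨h1', h2'⟩, fun ht ↦ ⟨⟨h1 ht, ht.1⟩, ht.2⟩⟩
    have e2 : (Pinf.I' ∩ (I'' ∩ univ)) \ E' n = I'' \ E' n := by
      ext t; simp only [inter_univ, Set.mem_sdiff, mem_inter_iff]
      exact ⟨fun ⟨⟨_, h1'⟩, h2'⟩ ↦ ⟨h1', h2'⟩, fun ht ↦ ⟨⟨h2 ht, ht.1⟩, ht.2⟩⟩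
    show J ∩ Pinf.I' ⊆ ((P n).I' ∩ (I'' ∩ univ)) \ E' n ∧
      ((P n).I' ∩ (I'' ∩ univ)) \ E' n = (Pinf.I' ∩ (I'' ∩ univ)) \ E' n ∧
      (Pinf.I' ∩ (I'' ∩ univ)) \ E' n ⊆ ℭ.dom (some n) ∩ ℭ.dom none
    rw [e1, e2]
    exact ⟨fun t ht ↦ hJ ht.1, rfl, fun t ht ↦ ⟨hE₁ ht, hE₂ ht⟩⟩
  · -- `|E n| ≤ (r n)² → 0`
    have hsq : Tendsto (fun n ↦ ENNReal.ofReal (r n ^ 2)) atTop (𝓝 0) := by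
      have := (hrt.pow 2)
      rw [zero_pow two_ne_zero] at this
      rw [← ENNReal.ofReal_zero]
      exact ENNReal.tendsto_ofReal this
    refine tendsto_of_tendsto_of_tendsto_of_le_of_le' tendsto_const_nhds hsq
      (Eventually.of_forall fun _ ↦ zero_le) ?_
    filter_upwards [hadm] with n hn using hn.volume_le
  · -- the supremum of the `W₁`-distances is `≤ r n → 0`
    have hrt' : Tendsto (fun n ↦ ENNReal.ofReal (r n)) atTop (𝓝 0) := by
      rw [← ENNReal.ofReal_zero]; exact ENNReal.tendsto_ofReal hrt
    refine tendsto_of_tendsto_of_tendsto_of_le_of_le' tendsto_const_nhds hrt'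
      (Eventually.of_forall fun _ ↦ zero_le) ?_
    filter_upwards [hadm] with n hn
    refine iSup_le fun t ↦ iSup_le fun h₁ ↦ iSup_le fun h₂ ↦ iSup_le fun ht ↦ ?_
    have ht' : t ∈ I'' \ E' n := ⟨ht.1.2.1, ht.2⟩
    exact hn.wassersteinW1_map_le ht' h₁ h₂

end Literature.Geometry.Riemannian

end
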